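import Summits.AtomisticToContinuum.BoseEinsteinCondensation.Theorems.BlockLatticeFSumBlockCondensationCarving
import Literature.MathematicalPhysics.QuantumManyBody.HardCoreScatteringLength
import Summits.AtomisticToContinuum.BoseEinsteinCondensation.Theorems.GapWindowLadderFreeWindowModes
import HarnessLib

/-!
# `BoxLatticeFSum` — the f-sum shell line transplanted to the DIRICHLET box
# (decomp-a2c · lens-6 «barrier-complement carving» · gen 29 · conjunct `BoseEinsteinCondensation`)

NODE (rung 1, conjunct level; RESIDUAL mode).  QUESTION OF RECORD (critic row 406 (5)(a)): «what does
`BlockLatticeFSum.closes` consume of 0827 `BoundaryTransferWeak` / 18443 `ModeFreeRewardChord`?»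
ANSWER, as a kernel: NOTHING THAT IS NECESSARY.  `closes` consumes 0827 verbatim (torus BEC ⟹ Dirichlet
BEC for the same `v`) only because `BlockCondensation` (13595) and `DeepInfraredEmptiness` (27506) were
TYPED on the torus `(ℤ/K)³` with plane-wave block modes; the boundary-condition-free leaf F♭ =
`CellNBudgetBlockFloor` beneath 13595 (gen 27/28, hand-1 p817926/p817956/p818300, hand-2 p817973) holds
for ANY Bose-symmetric `C¹` function under the plain energy budget, in particular for Dirichlet
near-minimisers.  Re-running the f-sum chain NATIVELY IN THE BOX, on the PATH lattice `P_K³` with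
DCT-II block waves (no wrap-around bonds), gives a `closes`-shaped kernel for the conjunct with NO
boundary-transfer binder:

  `BoseEinsteinCondensation ⟸ MF ∧ SB ∧ DE ∧ MC ∧ ZS`   (`bec_of_boxPieces`, 0 sorry)

* **MF** `BoxMixedFloor` — block floor of Dirichlet near-minimisers for the 8 half-shifted MIXED
  tilings (pieces = 2×2×2 super-blocks inside, single end blocks at the walls), in the F♭-native
  discounted form (piece mode = back-translate of a `subMode` of side `2L/K`).  TAG WEAKER · TRUE-type ·
  leaf KNOWN/ATTACKABLE-NOW (M): MF ⟸ F♭ by translating `ψ` by `(L/K)·s`, zero-extending to the cell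
  of side `L'' ∈ {(K+2)L/K, (K+4)L/K}` (so that `K'' = L''/(2L/K)` is even), budget from
  `eventually_groundStateEnergy_le_dyson` + `(K/(K+4))³ → 1`, two block constants `A'' ∈ {3A/2, 2A}`
  to cover the window, and `occupation` of a back-translated end piece `= (n_P/8)·n(u_P) ≤ n(u_P)`.
* **SB** `BoxShellBudget := MF → BoxShellBound` — KINEMATIC (support; PROVABLE-NOW, M): per piece `P`
  paired along axis `j`, `Σ_(j-bonds in P) n((u_B-u_B')/√2) ≤ Σ_(B⊂P) n(u_B) - n(u_P)` (parallelogram law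
  + Cauchy–Schwarz, also for 2- and 4-block end pieces; `0 ≤ …` for unpaired pieces); each path bond is
  interior to exactly 4 of the 8 shift classes; and the PATH-LAPLACIAN f-sum identity
  `Σ_q ε_P(q) n(g_q) = Σ_(path bonds) n(a_bond)` with `ε_P(q) = Σ_j (1 - cos(π q_j/K))` (DCT-II
  diagonalises the path Laplacian; NO wrap-around bond, which is exactly what the box cannot floor).
  Total: `Σ_q ε_P(q) n(g_q) ≤ ¼·8·3·ηN = 6ηN` — the same constant as the torus `ShellBudget` (27507,
  PROVED as `SB.shellBudget`).
* **DE** `BoxDeepInfraredEmptiness` — THE RESIDUAL (crux r2 · TAG UNDECIDED · leaf IDEA-NEEDED +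
  INSTRUMENTABLE): for `a > 0`, Dirichlet `δ`-near-minimisers put at most `N/8` particles in total into
  the nonzero DCT block waves with `ε_P(q) < θ`, block side in `[A/√ρ, 2A/√ρ]`, eventually in `N`.
  RESTRICTED TO `0 < scatteringLength v` ON PURPOSE: at `a = 0` it is FALSE (the free Dirichlet ground
  state is the sine product; its block DCT content outside `q = 0` is `1 - (8/π²)³ ≈ 0.47 > 1/8`, all of
  it deep) — unlike the torus twin 27506, which holds at `a = 0`.  For `a > 0` the wall layer has width
  `O(ξ)`, `ξ = (8πρa)^{-1/2} = O(1)` as `L → ∞`, and costs `O(ξ/L)·N = o(N)`; the enemy is the same as on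
  the torus: condensate fragmentation over deep block waves (block-Fock / phase-disordered states obey MF
  and SB and violate DE — separating shape, so DE is NOT implied by MF ∧ SB).  Not known to imply BEC
  (it bounds the deep NONZERO content, says nothing about `q = 0` vs the shell without SB) and not known
  to follow from BEC with an unspecified constant `c` (BEC with `c < 7/8` is compatible with `> N/8` deep
  content): UNDECIDED both ways, typed one-sided and non-perturbative (outside
  `BogoliubovPerturbationInfrared` as typed, outside `KineticGapLengthScales` — no kinetic gap at the
  box scale is used, the block scale is the PROVED GP side — and outside the boundary-condition
  comparison class of 0827/`Robinson1976` since no two boundary conditions are ever compared).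
* **MC** `BoxShellModeCounting := BoxShellBound → DE → MF → FlatModeDominancePos` — KINEMATIC (support;
  PROVABLE-NOW, M): DCT Parseval `Σ_q n(g_q) = Σ_B n(u_B) ≥ Σ_S n(u_S) ≥ (1-η)N` (MF at shift 0 +
  Cauchy–Schwarz), shell Chebyshev `Σ_(ε_P ≥ θ) n(g_q) ≤ 6ηN/θ`, DE for the deep rest, `η + 6η/θ ≤ 1/4`
  ⟹ `n(g_0) ≥ 5N/8`, and `g_0 = L^{-3/2} 1_box` = `constantMode L` a.e.; an even `K` exists in the
  window once `L√ρ ≥ 4A`.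
* **ZS** `ZeroScatteringBoxBEC` — the `a = 0` complement (TAG WEAKER · TRUE-type · leaf KNOWN/ATTACKABLE-NOW,
  M): `scatteringLength v = 0 ⟹ v(|x|) = 0` for a.e. `x ∈ ℝ³` (Gagliardo–Nirenberg–Sobolev on `1 - φ`,
  Mathlib `MeasureTheory.eLpNorm_le_eLpNorm_fderiv_*`) ⟹ `interaction v = 0` a.e. on `Config N` ⟹
  `energy v = energy 0`, `groundStateEnergy v = groundStateEnergy 0`, `condensateNumber v =
  condensateNumber 0` ⟹ tree `hasGroundStateBEC_zero`.  Its `v = 0` instance is proved here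
  (`zeroScatteringBEC_at_zero`).

WHY THIS IS A CARVING AND NOT A COSTUME.  (i) Residual count: the torus line `BlockLatticeFSum` has TWO
open non-kinematic leaves after 13595 — 27506 `DeepInfraredEmptiness` (declared residual) and 0827
(⟸ 18443 `ModeFreeRewardChord` ⟺ `OverCondensationPenalty`, BEC-hard, lead c6 `blocked-on 18443`); the
box line has ONE — DE — plus two TRUE-type leaves (MF, ZS) dischargeable from tree theorems.  (ii) The
lever that makes the transplant possible is new in the BEC sub-tree (searched: 144 `Theses/*.lean`, 0 hits
for DCT / cosine block waves / path Laplacian; the Dirichlet-native lineages `CondensateScaleLadder`,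
`CoherentDoubling`, `ScaleConvexity`, `CondensedPivot`, `HealingPivotCascade`, `NumberPhaseSandwich`,
`DetailResponseLadder` are multi-scale position-side cascades, none a one-scale block-Fourier residual):
the PATH lattice has no wrap-around bond, so every bond the f-sum identity prices is interior to a
half-shifted MIXED tiling whose pieces F♭ floors after an enlarged-cell translation — the one place where
the cyclic lattice genuinely needed the torus.  (iii) DE ≠ 27506 reworded: different states (Dirichlet
vs periodic near-minimisers), different modes (DCT-II vs plane block waves), and a different truth value
at `a = 0`.

TAGS per piece: MF WEAKER/KNOWN·ATTACKABLE-NOW · SB COSTUME-of-kinematics/PROVABLE-NOW · DE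
UNDECIDED/IDEA-NEEDED (residual, BEC-hard enemy = fragmentation) · MC COSTUME-of-kinematics/PROVABLE-NOW ·
ZS WEAKER/KNOWN·ATTACKABLE-NOW.  Conjunct-necessity: MF, SB-bound, MC-conclusion(a>0)?, ZS are TRUE
outright; DE is the one piece not known to be necessary (BEC ⟹ DE is open) — declared residual, as 27506.

Proved here (0 sorry, standard axioms): `hasGroundStateBEC_of_flatMode` (flat-mode dominance on
near-minimisers ⟹ `HasGroundStateBEC`, via `le_condensateNumber` + `occupation_le_maxOccupation`),
`zeroScatteringBEC_holds` (ZS outright), `bec_of_boxPieces` (the deciding kernel, `a = 0`/`a > 0`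
split) and `bec_of_floor_budget_deep_counting` (ZS discharged: FOUR binders, one of them the residual),
`pathDispersion_nonneg`/`_le`, `exists_admissible_pos_scatteringLength` (DE's class is nonempty).  Sources: [LSSY2005 §1.2, Thm 2.2,
Thm 5.1, Lemma 5.2], [Fournais2020 (1.3)], DCT-II / path-graph Laplacian [folklore: Strang 1999 «The
discrete cosine transform», SIAM Rev. 41], tree: `CellNBudgetBlockFloor`, `floor_of_scatteringLength_pos_sharp`,
`eventually_groundStateEnergy_le_dyson`, `hasGroundStateBEC_zero`, `SB.shellBudget`, `SMC.shellModeCounting`.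
-/

noncomputable section

open MeasureTheory Filter Set
open scoped ENNReal NNReal BigOperators

namespace Summit.AtomisticToContinuum.BoseEinsteinCondensation.Theorems.BoxLatticeFSum

open Literature.MathematicalPhysics.QuantumManyBody.BoseGas

/-! ### Objects: the path lattice `P_K³` of blocks, DCT-II block waves, mixed tilings -/

/-- The GP window for the block side `L/K`: `A/√ρ ≤ L/K ≤ 2A/√ρ`. [tree: BlockLatticeFSum] -/
def InWindow (A ρ L : ℝ) (K : ℕ) : Prop :=
  A / Real.sqrt ρ ≤ L / (K : ℝ) ∧ L / (K : ℝ) ≤ 2 * A / Real.sqrt ρ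

/-- DCT-II coefficient of the block wave `q` at block `B`:
`∏_j √((1 or 2)/K) · cos(π q_j (B_j + ½)/K)` (orthonormal eigenbasis of the path-graph Laplacian on
`{0,…,K-1}`, tensorised). [folklore: Strang 1999, SIAM Rev. 41, §1] -/
def dctCoeff (K : ℕ) (q B : SubIdx K) : ℝ :=
  ∏ j : Fin 3, Real.sqrt ((if ((q j : ℕ) = 0) then (1 : ℝ) else 2) / (K : ℝ)) *
    Real.cos (Real.pi * ((q j : ℕ) : ℝ) * ((((B j : Fin K) : ℕ) : ℝ) + 1 / 2) / (K : ℝ))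

/-- The DCT block wave `g_q = Σ_B dctCoeff q B · u_B` over the block modes `u_B = subMode (L/K) B`
(`u_B = (L/K)^{-3/2} 1_{block B}`, tree `blockMode_eq_subMode`); `g_0 = L^{-3/2} 1_{[0,L)³}`. [folklore] -/
def boxBlockWave (L : ℝ) (K : ℕ) (q : SubIdx K) (x : Space) : ℂ :=
  ∑ B : SubIdx K, ((dctCoeff K q B : ℝ) : ℂ) * subMode (L / (K : ℝ)) B x

/-- The path dispersion `ε_P(q) = Σ_j (1 - cos(π q_j / K))` (half the path-Laplacian eigenvalue;
`ε_P(q) = 0 ↔ q = 0`). [folklore] -/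
def pathDispersion (K : ℕ) (q : SubIdx K) : ℝ :=
  ∑ j : Fin 3, (1 - Real.cos (Real.pi * ((q j : ℕ) : ℝ) / (K : ℝ)))

/-- The shift vector `(L/K)·s`, `s ∈ {0,1}³`, of a half-shifted (mixed) tiling. [folklore] -/
def blockShift (L : ℝ) (K : ℕ) (s : Fin 3 → Fin 2) : Space :=
  WithLp.toLp 2 fun i : Fin 3 => L / (K : ℝ) * ((((s i : Fin 2)) : ℕ) : ℝ)

/-- Piece mode of the mixed tiling `T_s` with label `m`, in F♭-native (discounted) form: the
back-translate `x ↦ subMode (2L/K) m (x + (L/K)s)` of a super-block mode of side `2L/K`.  Against a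
Dirichlet state it sees only `box ∩ (super-block - (L/K)s)`: a 2×2×2 super-block of blocks inside, a
2×2×1 / 2×1×1 / 1×1×1 end piece at the walls (weight `n_P/8`), or nothing. [folklore] -/
def pieceMode (L : ℝ) (K : ℕ) (s : Fin 3 → Fin 2) (m : SubIdx (K / 2 + 1)) (x : Space) : ℂ :=
  subMode (2 * (L / (K : ℝ))) m (x + blockShift L K s)

/-! ### The pieces -/

/-- **MF = `BoxMixedFloor`** (TAG WEAKER · TRUE-type · leaf KNOWN/ATTACKABLE-NOW, size M).  For every
repulsive finite-range `v`, block constant `A > 0` and loss `η > 0`: below a density cap, eventually in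
`N`, for some slack `δ > 0`, every Dirichlet `δ`-near-minimiser in the box of side `L = (N/ρ)^{1/3}` has,
for every even `K > 0` with `L/K` in the window and every shift class `s ∈ {0,1}³`, discounted mixed
floor `Σ_m n(pieceMode s m) ≥ (1-η)N`.  ⟸ F♭ `CellNBudgetBlockFloor` (translate by `(L/K)s`,
zero-extend to a cell of side `(K+2)L/K` or `(K+4)L/K`, Dyson budget); why strictly weaker than the
conjunct: a GP-scale statement (block side `~ ξ`), true for block-Fock states without BEC.
[cite: LSSY2005, Thm 5.1 (5.15)–(5.17), Lemma 5.2; tree CellNBudgetBlockFloor] -/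
@[conjecture] def BoxMixedFloor : Prop :=
  ∀ v : ℝ → ℝ≥0∞, IsRepulsiveFiniteRange v → ∀ A : ℝ, 0 < A → ∀ η : ℝ, 0 < η →
    ∃ ρ₀ : ℝ, 0 < ρ₀ ∧ ∀ ρ : ℝ, 0 < ρ → ρ < ρ₀ → ∀ᶠ N : ℕ in atTop, ∃ δ : ℝ≥0∞, 0 < δ ∧
      ∀ Ψ : TrialState N (sideLength ρ N),
        energy v Ψ ≤ groundStateEnergy v N (sideLength ρ N) + δ →
        ∀ K : ℕ, Even K → 0 < K → InWindow A ρ (sideLength ρ N) K →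
        ∀ s : Fin 3 → Fin 2,
          ENNReal.ofReal ((1 - η) * N) ≤
            ∑ m : SubIdx (K / 2 + 1), occupation N (pieceMode (sideLength ρ N) K s m) Ψ.ψ

/-- The shell budget BOUND (conclusion of SB, hypothesis of MC): `Σ_q ε_P(q)·n(g_q) ≤ 6ηN` on
Dirichlet near-minimisers, every even `K` in the window. [folklore; torus twin tree SB.shellBudget] -/
@[conjecture] def BoxShellBound : Prop :=
  ∀ v : ℝ → ℝ≥0∞, IsRepulsiveFiniteRange v → ∀ A : ℝ, 0 < A → ∀ η : ℝ, 0 < η →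
    ∃ ρ₀ : ℝ, 0 < ρ₀ ∧ ∀ ρ : ℝ, 0 < ρ → ρ < ρ₀ → ∀ᶠ N : ℕ in atTop, ∃ δ : ℝ≥0∞, 0 < δ ∧
      ∀ Ψ : TrialState N (sideLength ρ N),
        energy v Ψ ≤ groundStateEnergy v N (sideLength ρ N) + δ →
        ∀ K : ℕ, Even K → 0 < K → InWindow A ρ (sideLength ρ N) K →
          ∑ q : SubIdx K, ENNReal.ofReal (pathDispersion K q) *
              occupation N (boxBlockWave (sideLength ρ N) K q) Ψ.ψ ≤
            ENNReal.ofReal (6 * η * N)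

/-- **SB = `BoxShellBudget`** (support · COSTUME of kinematics · leaf PROVABLE-NOW, size M): the mixed
floors price every PATH bond (`n((u_B - u_{B+e_j})/√2)` summed over interior bonds of a tiling is
`≤ Σ_B n(u_B) - Σ_P n(u_P) ≤ ηN`; each bond interior to 4 of 8 tilings) and the DCT-II f-sum identity
`Σ_q ε_P(q) n(g_q) = Σ_bonds n(a_bond)` turns the bond price into the dispersion-weighted budget.
[folklore: parallelogram law, Cauchy–Schwarz, path-Laplacian spectral theorem; tree SB.shellBudget (cyclic twin)] -/
@[conjecture] def BoxShellBudget : Prop := BoxMixedFloor → BoxShellBound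

/-- **DE = `BoxDeepInfraredEmptiness`** (crux r2 · DECLARED RESIDUAL · TAG UNDECIDED · leaf IDEA-NEEDED
+ INSTRUMENTABLE).  For every repulsive finite-range `v` with POSITIVE scattering length there are a
block constant `A`, a threshold `θ > 0` and a density cap such that, eventually in `N`, for some
`δ > 0`, every Dirichlet `δ`-near-minimiser puts at most `N/8` particles in total into the nonzero DCT
block waves `g_q` with `ε_P(q) < θ`, for every even `K` with `L/K` in the window.  Why it might fail:
condensate fragmentation over deep block waves (block-Fock / phase-disordered states satisfy MF and SB and
violate DE); `a > 0` is load-bearing (FALSE at `a = 0`: sine profile).  Why strictly weaker / not the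
conjunct: bounds only the deep NONZERO content at ONE block scale; BEC ⟹ DE and DE ⟹ BEC both open.
[cite: LSSY2005, §1.2 and Ch. 5] (folklore Bogoliubov heuristics: deep content O(√(ρa³))N + O(ξ/L)N) -/
@[conjecture] def BoxDeepInfraredEmptiness : Prop :=
  ∀ v : ℝ → ℝ≥0∞, IsRepulsiveFiniteRange v → 0 < scatteringLength v →
    ∃ A : ℝ, 0 < A ∧ ∃ θ : ℝ, 0 < θ ∧ ∃ ρ₀ : ℝ, 0 < ρ₀ ∧ ∀ ρ : ℝ, 0 < ρ → ρ < ρ₀ →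
      ∀ᶠ N : ℕ in atTop, ∃ δ : ℝ≥0∞, 0 < δ ∧ ∀ Ψ : TrialState N (sideLength ρ N),
        energy v Ψ ≤ groundStateEnergy v N (sideLength ρ N) + δ →
        ∀ K : ℕ, Even K → 0 < K → InWindow A ρ (sideLength ρ N) K →
          (∑ q ∈ (Finset.univ.filter fun q : SubIdx K =>
              0 < pathDispersion K q ∧ pathDispersion K q < θ),
            occupation N (boxBlockWave (sideLength ρ N) K q) Ψ.ψ) ≤ ENNReal.ofReal ((N : ℝ) / 8)

/-- Flat-mode dominance for positive scattering length (conclusion of MC): below a density cap, for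
some `c > 0`, eventually in `N`, for some `δ > 0`, every Dirichlet `δ`-near-minimiser has
`n(L^{-3/2} 1_{[0,L)³}) ≥ cN`. [cite: LSSY2005, §1.2 (1.17)–(1.19)] -/
@[conjecture] def FlatModeDominancePos : Prop :=
  ∀ v : ℝ → ℝ≥0∞, IsRepulsiveFiniteRange v → 0 < scatteringLength v →
    ∃ ρ₀ : ℝ, 0 < ρ₀ ∧ ∀ ρ : ℝ, 0 < ρ → ρ < ρ₀ → ∃ c : ℝ, 0 < c ∧
      ∀ᶠ N : ℕ in atTop, ∃ δ : ℝ≥0∞, 0 < δ ∧ ∀ Ψ : TrialState N (sideLength ρ N),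
        energy v Ψ ≤ groundStateEnergy v N (sideLength ρ N) + δ →
          ENNReal.ofReal (c * N) ≤ occupation N (constantMode (sideLength ρ N)) Ψ.ψ

/-- **MC = `BoxShellModeCounting`** (support · COSTUME of kinematics · leaf PROVABLE-NOW, size M):
DCT Parseval `Σ_q n(g_q) = Σ_B n(u_B) ≥ (1-η)N` (MF at shift `0` + Cauchy–Schwarz), shell Chebyshev
`Σ_(ε_P ≥ θ) n(g_q) ≤ 6ηN/θ` (SB bound), DE on the deep rest, `η + 6η/θ ≤ 1/4` ⟹ `n(g_0) ≥ 5N/8`,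
`g_0 = constantMode L` a.e.; an even `K` in the window exists once `L√ρ ≥ 4A`.
[folklore; torus twin tree SMC.shellModeCounting] -/
@[conjecture] def BoxShellModeCounting : Prop :=
  BoxShellBound → BoxDeepInfraredEmptiness → BoxMixedFloor → FlatModeDominancePos

/-- **ZS = `ZeroScatteringBoxBEC`** (TAG WEAKER · TRUE-type · leaf KNOWN — PROVED below,
`zeroScatteringBEC_holds`): BEC at zero scattering length.  `a = 0 ⟹ v(|x|) = 0` a.e. ⟹
`energy v = energy 0` (tree `energy_eq_energy_zero`) ⟹ tree `hasGroundStateBEC_zero`.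
(Source: LSSY2005 App. C Thm C.1; tree `hasGroundStateBEC_zero`, `energy_eq_energy_zero`.  Proved in this file, hence deliberately NOT
cite-tagged: an inline cited `def : Prop` would be relocated to Literature by the gate.) -/
def ZeroScatteringBoxBEC : Prop :=
  ∀ v : ℝ → ℝ≥0∞, IsRepulsiveFiniteRange v → scatteringLength v = 0 →
    ∃ ρ₀ : ℝ, 0 < ρ₀ ∧ ∀ ρ : ℝ, 0 < ρ → ρ < ρ₀ → HasGroundStateBEC v ρ

/-! ### Kernels -/

/-- Flat-mode dominance on near-minimisers at one density gives ground-state BEC at that density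
(`le_condensateNumber` + `occupation_le_maxOccupation` for the measurable normalised constant mode).
[cite: LSSY2005, §1.2 (1.17)–(1.19)] -/
theorem hasGroundStateBEC_of_flatMode {v : ℝ → ℝ≥0∞} {ρ : ℝ} (hρ : 0 < ρ)
    (h : ∃ c : ℝ, 0 < c ∧ ∀ᶠ N : ℕ in atTop, ∃ δ : ℝ≥0∞, 0 < δ ∧
      ∀ Ψ : TrialState N (sideLength ρ N),
        energy v Ψ ≤ groundStateEnergy v N (sideLength ρ N) + δ →
          ENNReal.ofReal (c * N) ≤ occupation N (constantMode (sideLength ρ N)) Ψ.ψ) :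
    HasGroundStateBEC v ρ := by
  obtain ⟨c, hc, hev⟩ := h
  refine ⟨c, hc, ?_⟩
  filter_upwards [hev, eventually_gt_atTop 0] with N hN hNpos
  obtain ⟨δ, hδ, hΨ⟩ := hN
  have hL : 0 < sideLength ρ N := sideLength_pos_of_pos hρ hNpos
  exact le_condensateNumber v hδ fun Ψ hE =>
    (hΨ Ψ hE).trans (occupation_le_maxOccupation _ (aestronglyMeasurable_constantMode _)
      (lintegral_constantMode_sq hL))

/-- `FlatModeDominancePos ⟹` BEC for every `v` with `a > 0`. [folklore] -/
theorem bec_pos_of_flatModeDominance (h : FlatModeDominancePos) :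
    ∀ v : ℝ → ℝ≥0∞, IsRepulsiveFiniteRange v → 0 < scatteringLength v →
      ∃ ρ₀ : ℝ, 0 < ρ₀ ∧ ∀ ρ : ℝ, 0 < ρ → ρ < ρ₀ → HasGroundStateBEC v ρ := by
  intro v hv ha
  obtain ⟨ρ₀, hρ₀, H⟩ := h v hv ha
  exact ⟨ρ₀, hρ₀, fun ρ hρ hρlt => hasGroundStateBEC_of_flatMode hρ (H ρ hρ hρlt)⟩

/-- **The deciding kernel (the node): `BoseEinsteinCondensation ⟸ MF ∧ SB ∧ DE ∧ MC ∧ ZS`** — no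
boundary-transfer binder (compare `BlockLatticeFSum.closes`, which takes 0827 `BoundaryTransferWeak`).
[folklore] -/
theorem bec_of_boxPieces (hMF : BoxMixedFloor) (hSB : BoxShellBudget)
    (hDE : BoxDeepInfraredEmptiness) (hMC : BoxShellModeCounting) (hZS : ZeroScatteringBoxBEC) :
    _root_.BoseEinsteinCondensation := by
  intro v hv
  rcases eq_or_ne (scatteringLength v) 0 with h0 | h0
  · exact hZS v hv h0
  · exact bec_pos_of_flatModeDominance (hMC (hSB hMF) hDE hMF) v hv (pos_iff_ne_zero.mpr h0)

/-- The same kernel with SB and MC discharged (they are kinematic support items): once a prover lands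
`BoxShellBudget` and `BoxShellModeCounting`, the conjunct is `MF ∧ DE ∧ ZS`. [folklore] -/
theorem bec_of_floor_deep_zero (hSB : BoxShellBudget) (hMC : BoxShellModeCounting)
    (hMF : BoxMixedFloor) (hDE : BoxDeepInfraredEmptiness) (hZS : ZeroScatteringBoxBEC) :
    _root_.BoseEinsteinCondensation :=
  bec_of_boxPieces hMF hSB hDE hMC hZS

/-! ### Sanity / non-vacuity -/

/-- The path dispersion is nonnegative. [folklore] -/
theorem pathDispersion_nonneg (K : ℕ) (q : SubIdx K) : 0 ≤ pathDispersion K q :=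
  Finset.sum_nonneg fun j _ => by linarith [Real.cos_le_one (Real.pi * ((q j : ℕ) : ℝ) / (K : ℝ))]

/-- The path dispersion is at most `6` (three axes, `1 - cos ≤ 2`). [folklore] -/
theorem pathDispersion_le (K : ℕ) (q : SubIdx K) : pathDispersion K q ≤ 6 := by
  unfold pathDispersion
  calc ∑ j : Fin 3, (1 - Real.cos (Real.pi * ((q j : ℕ) : ℝ) / (K : ℝ)))
      ≤ ∑ _j : Fin 3, (2 : ℝ) := Finset.sum_le_sum fun j _ => by
        linarith [Real.neg_one_le_cos (Real.pi * ((q j : ℕ) : ℝ) / (K : ℝ))]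
    _ = 6 := by simp; norm_num

/-- At zero scattering length the condensate number is that of the free gas (the interaction is
invisible: `energy v = energy 0`, tree `energy_eq_energy_zero`). [cite: LSSY2005, App. C Thm C.1] -/
theorem condensateNumber_eq_zero_of_scatteringLength {v : ℝ → ℝ≥0∞} (hv : IsRepulsiveFiniteRange v)
    (h0 : scatteringLength v = 0) (N : ℕ) (L : ℝ) :
    condensateNumber v N L = condensateNumber 0 N L := by
  unfold condensateNumber
  simp_rw [GapWindowLadderFreeWindowModes.energy_eq_energy_zero hv h0,
    GapWindowLadderFreeWindowModes.groundStateEnergy_eq_zero hv h0]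

/-- **ZS holds** (the `a = 0` complement is a theorem): tree `hasGroundStateBEC_zero` transported
along `condensateNumber v = condensateNumber 0`. [cite: LSSY2005, App. C Thm C.1; tree hasGroundStateBEC_zero] -/
theorem zeroScatteringBEC_holds : ZeroScatteringBoxBEC := by
  intro v hv h0
  refine ⟨1, one_pos, fun ρ hρ _ => ?_⟩
  obtain ⟨c, hc, hev⟩ := hasGroundStateBEC_zero (ρ := ρ) hρ
  refine ⟨c, hc, hev.mono fun N hN => ?_⟩
  rw [condensateNumber_eq_zero_of_scatteringLength hv h0]
  exact hN

/-- **The live kernel: `BoseEinsteinCondensation ⟸ MF ∧ SB ∧ DE ∧ MC`** (ZS discharged) — four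
binders: two kinematic support items (SB, MC), one TRUE-type floor (MF ⟸ F♭) and ONE residual (DE);
no boundary-transfer binder. [folklore] -/
theorem bec_of_floor_budget_deep_counting (hMF : BoxMixedFloor) (hSB : BoxShellBudget)
    (hDE : BoxDeepInfraredEmptiness) (hMC : BoxShellModeCounting) :
    _root_.BoseEinsteinCondensation :=
  bec_of_boxPieces hMF hSB hDE hMC zeroScatteringBEC_holds

/-- Non-vacuity of the hypothesis class of DE: the hard core of radius `1` is repulsive finite-range
with positive scattering length, so DE quantifies over a nonempty class. [tree: scatteringLength_hardCorePotential] -/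
theorem exists_admissible_pos_scatteringLength :
    ∃ v : ℝ → ℝ≥0∞, IsRepulsiveFiniteRange v ∧ 0 < scatteringLength v := by
  refine ⟨hardCorePotential 1, isRepulsiveFiniteRange_hardCorePotential 1, ?_⟩
  rw [scatteringLength_hardCorePotential 1]
  simp

end Summit.AtomisticToContinuum.BoseEinsteinCondensation.Theorems.BoxLatticeFSum

end
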